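import Literature.AnabelianGeometry.SemiGraphs.SubgroupPresentationCloseEquivariantRigidity
import Literature.AnabelianGeometry.SemiGraphs.SubgroupPresentationArithAction
import HarnessLib

/-!
# [SemiAnbd] Prop 5.2 (i) proof at the coset semi-graphs, arithmetic action: an element of the arithmetic group whose
# automorphism and conjugators are congruent to `1` modulo a deep level acts on a connected coset level as an INNER
# automorphism modulo that level (piece (P2b) of the «T54-HCCT-PRODUCER» programme; proof-only)

Mochizuki, *Semi-graphs of anabelioids*, Publ. RIMS **42** (2006) 221–322, §5: Def 5.1 (i) p. 62, Prop 5.2 (i) p. 63 and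
its proof p. 64 («the various finiteness assumptions»), p. 65 (decomposition groups up to conjugation), proof of Thm 5.4
p. 66 («entirely parallel» to Thm 3.7: the arithmetic tempered group acts on the trees of the Galois tower).
[cite: MochizukiSemiAnbd2006, Prop 5.2 (i), p. 63]

PROOF-ONLY file (abc-iut cell, layer L3, row «T54-HCCT-PRODUCER», abc-iut-L3-lead δ7 (7) / δ23; seat abc-iut-w4-d085
gen 10; piece (P2b) of `HOME/staging/w4/w4-d085/g10/SHAPES-T54-HCCT.md`).  No definition, no instance, no new named fact.
Over abc-iut-L3-d4's `SubgroupPresentationArithAction.lean` (the CANONICAL arithmetic action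
`P.arithAct hP K hK : E →* Aut (P.cosetGraph K)` of a group `E` acting on `Γ` by `Φ : E →* MulAut Γ` and on `𝔾` by
`σ : E →* Aut 𝔾` under `IsArithCompatible`, extending the deck action along the inner action `ι : Γ →* E`) and this
seat's `SubgroupPresentationCloseEquivariantRigidity.lean` (P2a, rigidity of close deck-equivariant endomorphisms).

* `arithAct_nodeMap_close` — if `σ e = 1`, `Φ_e(g)·g⁻¹ ∈ L` for all `g`, and `e` admits at every vertex / edge a
  conjugator IN `L` (`L ⊴ Γ` normal, `K ≤ L`), then `arithAct e` moves every node of the level-`K` coset semi-graph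
  within its `L`-deck-orbit (`H_w y K ↦ H_w k⁻¹ Φ_e(y) K = deck(l) (H_w y K)` with `l⁻¹ = y⁻¹ k⁻¹ Φ_e(y) ∈ L`).
* `exists_finite_forall_arithAct_close_congr` — **(P2b)**: for a FINITE `𝔾`, a normal `Φ`-stable level `K` with
  finite images of the `H_w`, `M_ε` in `Γ ⧸ K` and CONNECTED `P.cosetGraph K`, and an inner action `ι` with
  `e · ι(g) · e⁻¹ = ι(Φ_e g)`: there is a FINITE `E₀ ⊆ Γ` avoiding `K` such that for every normal `L ⊇ K` avoiding `E₀`,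
  every `e ∈ E` with `σ e = 1`, `Φ_e ≡ id (mod L)` and vertex / edge conjugators in `L` has `Φ_e` INNER MODULO `K`:
  `Φ_e(g) = l₀ g l₀⁻¹ k_g`, `k_g ∈ K`, one `l₀ ∈ L` — the hypothesis shape of p512058 §3
  (`exists_rep_congr_of_forall_apply_eq_conj_mul`).  Equivariance `deck(g) ≫ arithAct e = arithAct e ≫ deck(Φ_e g)` is
  `arithAct_mul` + `arithAct_eq_deckAct_of_inner`.

INTENDED USE (piece (P3), not here): `E :=` the outer semidirect product `π₁^temp(𝒢) ⋊^out Π_A` of the T54 capstone with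
its `IsArithCompatible` term (`isArithCompatible_piPresentation_outerAction_of_branchPair_chart_of_finite`, from the
PRODUCED branch transport p460259), `K := ker (D.projAut n)`, `L :=` a deep finite characteristic level times `K`; the
elements `e = e_b⁻¹ e_a` for `a, b` near `1` with representatives `≡ id` modulo the finite level (p457557) and EQUAL
conjugator classes modulo `L` (a FINITE-valued invariant) satisfy the hypotheses here, so p512058 §3 + §1 yield the
capstone binder `hCCt`.  HONEST LABEL: pure group theory; nothing of [SemiAnbd] is discharged by this file alone; no side
taken on [IUTchIII] Cor. 3.12; typed ≠ proved.
-/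

namespace Literature.AnabelianGeometry.SemiGraphs

namespace SemiGraph

namespace SubgroupPresentation

open CategoryTheory
open scoped Pointwise

universe u v

variable {𝔾 : SemiGraph.{u}} {Γ : Type u} [Group Γ] {E : Type v} [Group E] (P : SubgroupPresentation 𝔾 Γ)
variable {Φ : E →* MulAut Γ} {σ : E →* Aut 𝔾} (hP : P.IsArithCompatible Φ σ)
variable (K : Subgroup Γ) (hK : ∀ (e : E) (x : Γ), x ∈ K → Φ e x ∈ K)

/-! ### Closeness of the arithmetic action of a «small» element -/

/-- **The arithmetic action of an element congruent to `1` modulo `L` moves nodes within their `L`-deck-orbits**: if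
`σ e = 1`, `Φ_e(g)·g⁻¹ ∈ L` for all `g` and `e` has at every vertex and every edge a conjugator lying in the normal
subgroup `L`, then for every node `x` of the level-`K` coset semi-graph `arithAct e · x = deck(l_x) · x` for some
`l_x ∈ L`. [cite: MochizukiSemiAnbd2006, Thm 5.4, p. 66] -/
theorem arithAct_nodeMap_close [K.Normal] (L : Subgroup Γ) [L.Normal] {e : E} (hσ : σ e = 1)
    (hΦ : ∀ g : Γ, Φ e g * g⁻¹ ∈ L) (hV : ∀ w : 𝔾.Vertex, ∃ k ∈ L, P.IsVConj Φ σ e w k)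
    (hE : ∀ ε : 𝔾.Edge, ∃ m ∈ L, P.IsEConj Φ σ e ε m) (x : (P.cosetGraph K).Node) :
    ∃ l ∈ L, Hom.nodeMap (P.arithAct hP K hK e).hom x = Hom.nodeMap (P.deckAct K l).hom x := by
  -- the common computation: `y⁻¹ k⁻¹ Φ_e(y) ∈ L`
  have key : ∀ (k y : Γ), k ∈ L → y⁻¹ * k⁻¹ * Φ e y ∈ L := by
    intro k y hk
    have h1 : y⁻¹ * k⁻¹ * y ∈ L := Subgroup.Normal.conj_mem' ‹L.Normal› _ (L.inv_mem hk) y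
    have h2 : y⁻¹ * (Φ e y * y⁻¹) * y ∈ L := Subgroup.Normal.conj_mem' ‹L.Normal› _ (hΦ y) y
    have : y⁻¹ * k⁻¹ * Φ e y = (y⁻¹ * k⁻¹ * y) * (y⁻¹ * (Φ e y * y⁻¹) * y) := by group
    rw [this]
    exact L.mul_mem h1 h2
  have hσV : ∀ w : 𝔾.Vertex, (σ e).hom.vertexMap w = w := fun w => by rw [hσ]; rfl
  have hσE : ∀ ε : 𝔾.Edge, (σ e).hom.edgeMap ε = ε := fun ε => by rw [hσ]; rfl
  have hσB : ∀ b : 𝔾.Branch, (σ e).hom.branchMap b = b := fun b => by rw [hσ]; rfl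
  rcases x with v | ε | br
  · obtain ⟨w, y, rfl⟩ := P.vMk_surjective K v
    obtain ⟨k, hk, hkc⟩ := hV w
    refine ⟨(y⁻¹ * k⁻¹ * Φ e y)⁻¹, L.inv_mem (key k y hk), ?_⟩
    change Sum.inl ((P.arithAct hP K hK e).hom.vertexMap (P.vMk K w y)) =
      Sum.inl ((P.deckAct K (y⁻¹ * k⁻¹ * Φ e y)⁻¹).hom.vertexMap (P.vMk K w y))
    rw [P.arithAct_vertexMap_vMk hP K hK hkc, P.deckAct_vertexMap_vMk]
    exact congrArg Sum.inl (P.vMk_eq K (hσV w) (congrArg _ (by group)))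
  · obtain ⟨ε, y, rfl⟩ := P.eMk_surjective K ε
    obtain ⟨m, hm, hmc⟩ := hE ε
    refine ⟨(y⁻¹ * m⁻¹ * Φ e y)⁻¹, L.inv_mem (key m y hm), ?_⟩
    change Sum.inr (Sum.inl ((P.arithAct hP K hK e).hom.edgeMap (P.eMk K ε y))) =
      Sum.inr (Sum.inl ((P.deckAct K (y⁻¹ * m⁻¹ * Φ e y)⁻¹).hom.edgeMap (P.eMk K ε y)))
    rw [P.arithAct_edgeMap_eMk hP K hK hmc, P.deckAct_edgeMap_eMk]
    exact congrArg (fun z => Sum.inr (Sum.inl z)) (P.eMk_eq K (hσE ε) (congrArg _ (by group)))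
  · obtain ⟨b, y, rfl⟩ := P.bMk_surjective K br
    obtain ⟨m, hm, hmc⟩ := hE (𝔾.edgeOf b)
    refine ⟨(y⁻¹ * m⁻¹ * Φ e y)⁻¹, L.inv_mem (key m y hm), ?_⟩
    change Sum.inr (Sum.inr ((P.arithHom hP K hK e).branchMap (P.bMk K b y))) =
      Sum.inr (Sum.inr ((P.deckAct K (y⁻¹ * m⁻¹ * Φ e y)⁻¹).hom.branchMap (P.bMk K b y)))
    rw [P.arithHom_branchMap_bMk hP K hK hmc, P.deckAct_branchMap_bMk]
    refine congrArg (fun z => Sum.inr (Sum.inr z)) (P.branch_eq K (hσB b) ?_ (congrArg _ (by group)) _ _)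
    rw [hσB]

/-! ### (P2b): a small element of the arithmetic group acts as an inner automorphism modulo the level -/

/-- **(P2b) An element of the arithmetic group congruent to `1` modulo a deep level acts modulo `K` as an INNER
automorphism** ([SemiAnbd] Prop 5.2 (i) proof made explicit).  `𝔾` finite; `K ⊴ Γ` normal and `Φ`-stable with finite
images of the `H_w`, `M_ε` in `Γ ⧸ K`; `P.cosetGraph K` connected; `ι : Γ →* E` the inner action (`Φ (ι g) = conj g`,
`σ (ι g) = 1`, `e ι(g) e⁻¹ = ι(Φ_e g)`).  Then there is a FINITE `E₀ ⊆ Γ` avoiding `K` such that for every normal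
`L ⊇ K` avoiding `E₀` and every `e ∈ E` with `σ e = 1`, `Φ_e(g)·g⁻¹ ∈ L` (all `g`) and vertex / edge conjugators in `L`:
`Φ_e(g) = l₀ g l₀⁻¹ k_g` with `k_g ∈ K` for ONE `l₀ ∈ L`. [cite: MochizukiSemiAnbd2006, Prop 5.2 (i), p. 63] -/
theorem exists_finite_forall_arithAct_close_congr (hP : P.IsArithCompatible Φ σ)
    (hK : ∀ (e : E) (x : Γ), x ∈ K → Φ e x ∈ K) [K.Normal] [Finite 𝔾.Vertex] [Finite 𝔾.Edge] [Finite 𝔾.Branch]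
    (hH : ∀ w : 𝔾.Vertex, ((QuotientGroup.mk (s := K)) '' (P.H w : Set Γ)).Finite)
    (hM : ∀ ε : 𝔾.Edge, ((QuotientGroup.mk (s := K)) '' (P.M ε : Set Γ)).Finite)
    (hconn : (P.cosetGraph K).IsConnected)
    (ι : Γ →* E) (hιΦ : ∀ g : Γ, Φ (ι g) = MulAut.conj g) (hισ : ∀ g : Γ, σ (ι g) = 1)
    (hconj : ∀ (e : E) (g : Γ), e * ι g * e⁻¹ = ι (Φ e g)) :
    ∃ E₀ : Set Γ, E₀.Finite ∧ (∀ g ∈ E₀, g ∉ K) ∧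
      ∀ (L : Subgroup Γ), L.Normal → K ≤ L → (∀ g ∈ E₀, g ∉ L) →
        ∀ e : E, σ e = 1 → (∀ g : Γ, Φ e g * g⁻¹ ∈ L) →
          (∀ w : 𝔾.Vertex, ∃ k ∈ L, P.IsVConj Φ σ e w k) → (∀ ε : 𝔾.Edge, ∃ m ∈ L, P.IsEConj Φ σ e ε m) →
            ∃ l₀ ∈ L, ∀ g : Γ, ∃ k ∈ K, Φ e g = l₀ * g * l₀⁻¹ * k := by
  obtain ⟨E₀, hfin, hK₀, hmain⟩ := P.exists_finite_forall_close_deckEquivariant_congr K hH hM hconn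
  refine ⟨E₀, hfin, hK₀, fun L hL hKL hLE e hσ hΦ hV hE => ?_⟩
  haveI : L.Normal := hL
  -- equivariance: `deck(g) ≫ arithAct e = arithAct e ≫ deck(Φ_e g)` from `e ι(g) = ι(Φ_e g) e`
  have hequiv : ∀ g : Γ, (P.deckAct K g).hom ≫ (P.arithAct hP K hK e).hom =
      (P.arithAct hP K hK e).hom ≫ (P.deckAct K (Φ e g)).hom := by
    intro g
    have h1 : e * ι g = ι (Φ e g) * e := by rw [← hconj e g, inv_mul_cancel_right]
    have h2 := congrArg (P.arithAct hP K hK) h1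
    rw [map_mul, map_mul, P.arithAct_eq_deckAct_of_inner hP K hK (hιΦ g) (hισ g),
      P.arithAct_eq_deckAct_of_inner hP K hK (hιΦ (Φ e g)) (hισ (Φ e g))] at h2
    exact congrArg Iso.hom h2
  obtain ⟨l₀, hl₀, hcong, -⟩ := hmain L hL hKL hLE (Φ e) (P.arithAct hP K hK e).hom (fun k hk => hK e k hk)
    hequiv (P.arithAct_nodeMap_close hP K hK L hσ hΦ hV hE) hΦ
  exact ⟨l₀, hl₀, hcong⟩

end SubgroupPresentation

end SemiGraph

end Literature.AnabelianGeometry.SemiGraphs
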